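import Summits.HodgeConjecture.HodgeConjecture.Theorems.Ring2HypothesesAtlasCMSixfolds
import Summits.HodgeConjecture.HodgeConjecture.Theorems.Ring2HypothesesCMPowerTransport
import Summits.HodgeConjecture.HodgeConjecture.Theorems.Ring2HypothesesWeilComponentsSplit
import HarnessLib

/-!
# Ring 2, hypotheses axis — part XXIX: the supply node `PolarizedWeilDiscriminantExists` HOLDS

HONEST FRAMING (cell `pub-hodge-ring2`): research route conditional on HC_CM; not a corollary;
Q11.4-sentence-2 already refuted in dim ≥ 3. `HC_CM` = the binder `Theses.RankFourFaces.CMAbelianHodge`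
(stmt-HodgeConjecture-3052) BY NAME, always an argument, never a fact. Nothing algebraic is proved here: no Weil
class becomes algebraic in this file.

## What this part does (trigger XXIX.7 (e) of the cell map: a Literature theorem discharges a displayed binder)

Part VII-B (`Ring2HypothesesWeilComponentsLadder`) typed van Geemen's Lemma 5.2 — every polarized abelian
`2n`-fold of Weil type `(A, K = ℚ(√-d), h_K)` HAS a discriminant class `δ = det H ∈ ℚˣ/Nm(Kˣ)` — as the OPEN
obligation node `PolarizedWeilDiscriminantExists` and carried it as the hypothesis `(hE : …)` of every
"exactness" row of the δ-indexed component table: W3 (`R∞ ⟺ δ-table`), the sixfold assembly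
`W₆ ⟸ sixfold δ-table` (part XIV), the CM-sixfold cells (part XVI), T5 (part IX), the non-split rung R1′ from the
non-split cells (VII-B W4 / XXVIII S6). The Literature unit `lit` has since PROVED Lemma 5.2 on the tree's
carriers (`Literature.AlgebraicGeometry.VanGeemen1994.WeilDiscriminantOfHyperbolic`, rev. 3):
`exists_projectiveEmbedding_hasWeilDiscriminantNondeg` — for `0 < n`, `dim A = 2n`, `0 < d`, `φ ≫ φ = -d`
there are a projective embedding `e`, a rational `a ≠ 0` in `H²(ℙᴺ)` and a `δ` with
`HasWeilDiscriminantNondeg A φ n d (d·e^*a + φ^*e^*a) δ` (Gram determinant of a `K`-orthogonal frame of the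
Hodge–Riemann Hermitian form, non-degenerate by hard Lefschetz in degree one) — and, per chart, existence and
UNIQUENESS of the cell: `exists_hasWeilDiscriminantNondeg`, `existsUnique_hasWeilDiscriminantNondeg`.

So the node is now a THEOREM (§1, one term), and every row above is re-exported WITHOUT the binder (§2–§6):

* §2  W3 fact-free: `WeilClassesImaginaryQuadratic ↔ WeilClassesByComponent` — Weil's question (imaginary
      quadratic `K`, all `n ≥ 2`) IS the δ-table, in the kernel, no hypothesis.
* §3  `W₆ ↔ sixfold δ-table` (`SevenfoldWeilCensus.WeilSixfolds`, item stmt-2524, `↔ ∀ d δ, WeilClassesComponent 3 d δ`),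
      and `W₆ ↔ R1′ ∧ split sixfold cells` — both fact-free; the three `W₆ ⟸ pointed families + δ-VHC` rows of
      part XIV minus `hE` (`HC_CM`-free / `HC_CM` nominal / Tate-discharged).
* §4  part XVI's CM-sixfold cells minus `hE`.
* §5  R∞ from the δ-indexed leaves minus `hE` (T5 and its two siblings).
* §6  R1′ from the non-split cells: only the Landherr binder (forward `LandherrSplitCriterion`, or the converse
      node `LandherrHyperbolicOfSplitDiscriminant` of part XXVIII) remains.
* §7  audit conjunction.

HONEST COLUMN. (i) The node is DISCHARGED, not removed: VII-B's `@[conjecture] def` stays (append-only tree; count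
once) and `polarizedWeilDiscriminantExists_holds` inhabits it. (ii) The CM-field analogue
`PolarizedWeilDiscriminantCMExists` (part VII-C, Deligne's `δ ∈ F^×/Nm(E^×)` for a CM field `E/F`) is NOT covered by
the Literature theorem (imaginary-quadratic carriers only) and stays OPEN as typed. (iii) No VHC-side exactness:
`WeilVariationalHodgeQuadratic → ∀ δ, WeilVariationalHodgeComponent` (VII-B W7) has no converse here — that would need
LOCAL CONSTANCY of `δ` along a connected Weil family, which is not in the tree. (iv) Rows of the abelian-all axis that
carry `hE` (`Ring2AbelianAllFrameRankFour`, `…WeilFloor`, `…WeilSquarefree`) re-base in one term with §1; they are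
not touched here (single writer). (v) Koike's / Schoen's cyclic Pryms remain on the SPLIT cells (VII-B caution).

References. [vanGeemen1994HodgeAV] B. van Geemen, *An introduction to the Hodge conjecture for abelian varieties*,
LNM 1594 (1994), Lemma 5.2 (1)–(3) (PDF p. 220), 5.4–(5.4.1), Thm. 4.3, 6.12. [Markman2025SurveySecant] §1.1, §11.5
Step 1, §12 (preprint). [Markman2025SecantWeil] Thm. 1.5.1 (preprint, UNREFEREED). [Deligne1982HodgeCycles] §5.
[Abdulali1994FamiliesAV] Lemma 6.2. [MoonenZarhin1999LowDim] §5.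
-/

-- The summit's namespace repeats `HodgeConjecture` (summit = sub-problem); every file of the axis disables this linter.
set_option linter.dupNamespace false

noncomputable section

open CategoryTheory
open Literature.AlgebraicGeometry Literature.AlgebraicGeometry.Motives
open Literature.AlgebraicGeometry.HodgeTheory
open Literature.AlgebraicTopology.SingularHomology
open Literature.AlgebraicGeometry.VanGeemen1994
open Summit.HodgeConjecture.HodgeConjecture.WeilTypeLadder
open Summit.HodgeConjecture.HodgeConjecture.Theses
open Summit.HodgeConjecture.HodgeConjecture.Ring2.ClassTargets
open Summit.HodgeConjecture.HodgeConjecture.Ring2.Atlas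

namespace Summit.HodgeConjecture.HodgeConjecture.Ring2.Hypotheses

/-! ### §1 The node holds -/

/-- **Van Geemen's Lemma 5.2 (existence of the discriminant class), typed as the supply node
`PolarizedWeilDiscriminantExists` of part VII-B, HOLDS**: it is the Literature theorem
`VanGeemen1994.exists_projectiveEmbedding_hasWeilDiscriminantNondeg` (the Weil-class witness of the node is not even
needed). The node was the binder `hE` of rows W3, W4 (R1′), T5, the `W₆` assembly and the CM-sixfold cells; all are
re-exported below without it. [cite: vanGeemen1994HodgeAV, Lemma 5.2 (1)–(3) (PDF p. 220)] -/
theorem polarizedWeilDiscriminantExists_holds : PolarizedWeilDiscriminantExists :=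
  fun _ _ hn hd _ _ hA _ hφ _ ↦ exists_projectiveEmbedding_hasWeilDiscriminantNondeg hn hA hd hφ

/-- Chart form, re-exported for the axis: EVERY chart `(A, φ, e, a)` (`a ≠ 0` rational) of a polarized abelian
`2n`-fold of Weil type lies on EXACTLY ONE δ-cell of the component table. [cite: vanGeemen1994HodgeAV, Lemma 5.2 (3)] -/
theorem existsUnique_weilCell {n d : ℕ} (hn : 0 < n) (hd : 0 < d) {A : AbelianVariety ℂ} {φ : A ⟶ A}
    (hA : A.dim = 2 * n) (hφ : φ ≫ φ = -(d • 𝟙 A)) (e : ProjectiveEmbedding A.X)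
    {a : complexBetti (projectiveSpace e.n ℂ) 2} (ha : IsRationalClass a) (ha0 : a ≠ 0) :
    ∃! δ : weilNormResidueGroup d, HasWeilDiscriminantNondeg A φ n d
      ((d : ℂ) • complexBetti.map e.ι 2 a + complexBetti.map φ.hom.hom.hom 2 (complexBetti.map e.ι 2 a)) δ :=
  existsUnique_hasWeilDiscriminantNondeg hn hA hd hφ e ha ha0

/-! ### §2 W3 fact-free: Weil's question (imaginary quadratic `K`) IS the δ-table -/

/-- W3 (←) fact-free: the δ-table gives R∞. [cite: vanGeemen1994HodgeAV, Lemma 5.2 and 4.9–4.12] -/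
theorem weilClassesImaginaryQuadratic_of_byComponent_holds (h : WeilClassesByComponent) :
    WeilClassesImaginaryQuadratic :=
  weilClassesImaginaryQuadratic_of_byComponent polarizedWeilDiscriminantExists_holds h

/-- **W3 — EXACTNESS of the δ-indexing, FACT-FREE**: Weil's question R∞ for imaginary quadratic `K` (every `n ≥ 2`,
every `d`, every discriminant) is EQUIVALENT to the conjunction of the component targets
`WeilClassesComponent n d δ` over all `(n ≥ 2, d > 0, δ ∈ ℚˣ/Nm(K_dˣ))` — in the kernel, no hypothesis (VII-B's
`weilClassesImaginaryQuadratic_iff_byComponent` carried `hE`). [cite: vanGeemen1994HodgeAV, Lemma 5.2 (PDF p. 220)]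
[cite: Weil1977HodgeRing] -/
theorem weilClassesImaginaryQuadratic_iff_byComponent_holds : WeilClassesImaginaryQuadratic ↔ WeilClassesByComponent :=
  weilClassesImaginaryQuadratic_iff_byComponent polarizedWeilDiscriminantExists_holds

/-! ### §3 `W₆` (item stmt-HodgeConjecture-2524) IS the sixfold δ-table, fact-free -/

/-- Slice: `W₆` gives every sixfold cell `(3, d, δ)`. -/
theorem weilClassesComponent_three_of_weilSixfolds (hW : SevenfoldWeilCensus.WeilSixfolds) {d : ℕ} (hd : 0 < d)
    (δ : weilNormResidueGroup d) : WeilClassesComponent 3 d δ :=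
  fun A φ hA hX hφ _ _ _ _ _ c hcQ hcH hw ↦ weilSixfolds_iff_weilClassesOf.1 hW d hd A φ hA hX hφ c hcQ hcH hw

/-- `W₆ ⟸ sixfold δ-table`, fact-free (part XIV's `weilSixfolds_of_components` minus `hE`).
[cite: vanGeemen1994HodgeAV, Lemma 5.2] -/
theorem weilSixfolds_of_components_holds (hC : ∀ d : ℕ, 0 < d → ∀ δ, WeilClassesComponent 3 d δ) :
    SevenfoldWeilCensus.WeilSixfolds :=
  weilSixfolds_of_components polarizedWeilDiscriminantExists_holds hC

/-- **`W₆` EXACTNESS, FACT-FREE**: the shared item `WeilSixfolds` (stmt-HodgeConjecture-2524) is EQUIVALENT to the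
conjunction of the sixfold cells `(ℚ(√-d), 6, δ)`, `d > 0`, `δ ∈ ℚˣ/Nm(K_dˣ)`. [cite: vanGeemen1994HodgeAV, Lemma 5.2]
[cite: Markman2025SurveySecant, §12] -/
theorem weilSixfolds_iff_components :
    SevenfoldWeilCensus.WeilSixfolds ↔ ∀ d : ℕ, 0 < d → ∀ δ : weilNormResidueGroup d, WeilClassesComponent 3 d δ :=
  ⟨fun h _ hd δ ↦ weilClassesComponent_three_of_weilSixfolds h hd δ, weilSixfolds_of_components_holds⟩

/-- **`W₆ ↔ R1′ ∧ the split sixfold cells `(3, d, -1)`**, FACT-FREE: by cases on the existence of a hyperbolic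
`K`-symmetrised hyperplane class; the split case is part XXVIII's S1/S2 (the split cell covers the split locus by
van Geemen (5.4.1) forward, a tree theorem), the other case is the rung R1′ verbatim. Markman's F2 is NOT used.
[cite: vanGeemen1994HodgeAV, (5.4.1)] [cite: Markman2025SurveySecant, §11.5 Step 1] -/
theorem weilSixfolds_iff_nonsplitSixfolds_and_split_components :
    SevenfoldWeilCensus.WeilSixfolds ↔
      NonsplitSixfolds ∧ ∀ d : ℕ, 0 < d → WeilClassesComponent 3 d (splitDiscriminantClass 3 d) :=
  ⟨fun h ↦ ⟨nonsplitSixfolds_of_weilSixfolds h, fun _ hd ↦ weilClassesComponent_three_of_weilSixfolds h hd _⟩,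
    fun h ↦ weilSixfolds_of_nonsplitSixfolds_of_floor (hyperbolicSixfolds_of_split_components_holds h.2) h.1⟩

/-- **`W₆`, `HC_CM`-FREE (row W1′ per component), minus `hE`**: divisor-generated-CM-pointed `(3, d, δ)`-families +
δ-VHC give `WeilSixfolds`. [cite: vanGeemen1994HodgeAV, Thm. 4.3 and Lemma 5.2] [cite: Abdulali1994FamiliesAV, (1.1) and Lemma 6.2] -/
theorem weilSixfolds_of_divisorGeneratedCMPointed_holds
    (hP : ∀ d : ℕ, 0 < d → ∀ δ, DivisorGeneratedCMPointedWeilFamiliesComponent 3 d δ)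
    (hV : ∀ d : ℕ, 0 < d → ∀ δ, WeilVariationalHodgeComponent 3 d δ) : SevenfoldWeilCensus.WeilSixfolds :=
  weilSixfolds_of_divisorGeneratedCMPointed polarizedWeilDiscriminantExists_holds hP hV

/-- **`W₆`, `HC_CM` NOMINAL (row W1 per component), minus `hE`**: `HC_CM` is an ARGUMENT anchoring the CM fibre.
[cite: Deligne1982HodgeCycles, §5] [cite: Abdulali1994FamiliesAV, Lemma 6.2] -/
theorem weilSixfolds_of_HC_CM_holds (hCM : RankFourFaces.CMAbelianHodge)
    (hP : ∀ d : ℕ, 0 < d → ∀ δ, CMPointedWeilFamiliesComponent 3 d δ)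
    (hV : ∀ d : ℕ, 0 < d → ∀ δ, WeilVariationalHodgeComponent 3 d δ) : SevenfoldWeilCensus.WeilSixfolds :=
  weilSixfolds_of_HC_CM hCM polarizedWeilDiscriminantExists_holds hP hV

/-- **`W₆`, `HC_CM` DISCHARGED by Tate (row W1‴ per component), minus `hE`**: families through a CM-elliptic power
`E⁶`. [cite: vanGeemen1994HodgeAV, Thm. 4.3 and 5.7–5.11] [cite: Schoen1988HodgeWeil, §6] -/
theorem weilSixfolds_of_cmPowerPointed_holds
    (hP : ∀ d : ℕ, 0 < d → ∀ δ, CMPowerPointedWeilFamiliesComponent 3 d δ)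
    (hV : ∀ d : ℕ, 0 < d → ∀ δ, WeilVariationalHodgeComponent 3 d δ) : SevenfoldWeilCensus.WeilSixfolds :=
  weilSixfolds_of_cmPowerPointed polarizedWeilDiscriminantExists_holds hP hV

/-! ### §4 Part XVI's CM-sixfold cells, minus `hE` -/

/-- Degenerate CM-sixfold cell, `HC_CM`-FREE down to the leaves (XVI row W1′), minus `hE`.
[cite: vanGeemen1994HodgeAV, Thm. 4.3, Lemma 5.2 and Thm. 6.12] [cite: Abdulali1994FamiliesAV, Lemma 6.2] -/
theorem hodgeDegenerateCMSixfold_of_multiWeilGenerated_of_divisorGeneratedCMPointed_holds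
    (hgen : ∀ A, IsSimpleCMSixfold A → HasBalancedQuadraticEndomorphism A → IsDivisorMultiWeilGenerated A)
    (hP : ∀ d : ℕ, 0 < d → ∀ δ, DivisorGeneratedCMPointedWeilFamiliesComponent 3 d δ)
    (hV : ∀ d : ℕ, 0 < d → ∀ δ, WeilVariationalHodgeComponent 3 d δ) : HodgeDegenerateCMSixfold :=
  hodgeDegenerateCMSixfold_of_multiWeilGenerated_of_weilSixfolds hgen (weilSixfolds_of_divisorGeneratedCMPointed_holds hP hV)

/-- Degenerate CM-sixfold cell, `HC_CM` DISCHARGED by Tate (XVI row W1‴), minus `hE`.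
[cite: vanGeemen1994HodgeAV, Thm. 4.3 and 5.7–5.11] [cite: Schoen1988HodgeWeil, §6] -/
theorem hodgeDegenerateCMSixfold_of_multiWeilGenerated_of_cmPowerPointed_holds
    (hgen : ∀ A, IsSimpleCMSixfold A → HasBalancedQuadraticEndomorphism A → IsDivisorMultiWeilGenerated A)
    (hP : ∀ d : ℕ, 0 < d → ∀ δ, CMPowerPointedWeilFamiliesComponent 3 d δ)
    (hV : ∀ d : ℕ, 0 < d → ∀ δ, WeilVariationalHodgeComponent 3 d δ) : HodgeDegenerateCMSixfold :=
  hodgeDegenerateCMSixfold_of_multiWeilGenerated_of_weilSixfolds hgen (weilSixfolds_of_cmPowerPointed_holds hP hV)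

/-- Degenerate CM-sixfold cell with `HC_CM` NOMINAL (XVI row W1), minus `hE`. [cite: Deligne1982HodgeCycles, §5]
[cite: Abdulali1994FamiliesAV, Lemma 6.2] -/
theorem hodgeDegenerateCMSixfold_of_HC_CM_of_multiWeilGenerated_of_cmPointed_holds (hCM : RankFourFaces.CMAbelianHodge)
    (hgen : ∀ A, IsSimpleCMSixfold A → HasBalancedQuadraticEndomorphism A → IsDivisorMultiWeilGenerated A)
    (hP : ∀ d : ℕ, 0 < d → ∀ δ, CMPointedWeilFamiliesComponent 3 d δ)
    (hV : ∀ d : ℕ, 0 < d → ∀ δ, WeilVariationalHodgeComponent 3 d δ) : HodgeDegenerateCMSixfold :=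
  hodgeDegenerateCMSixfold_of_multiWeilGenerated_of_weilSixfolds hgen (weilSixfolds_of_HC_CM_holds hCM hP hV)

/-- **All simple CM sixfolds, `HC_CM`-FREE down to the leaves (XVI), minus `hE`**: (G₀) + (G) +
divisor-generated-CM-pointed `(3, d, δ)`-families + δ-VHC. [cite: vanGeemen1994HodgeAV, §2.4, Lemma 5.2 and Thm. 6.12]
[cite: Abdulali1994FamiliesAV, Lemma 6.2] [cite: Gordon1997, Thm. 6.4] -/
theorem hodgeSimpleCMSixfold_of_generation_of_divisorGeneratedCMPointed_holds
    (hgen₀ : ∀ A, IsSimpleCMSixfold A → ¬ HasBalancedQuadraticEndomorphism A → IsDivisorGenerated A)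
    (hgen : ∀ A, IsSimpleCMSixfold A → HasBalancedQuadraticEndomorphism A → IsDivisorMultiWeilGenerated A)
    (hP : ∀ d : ℕ, 0 < d → ∀ δ, DivisorGeneratedCMPointedWeilFamiliesComponent 3 d δ)
    (hV : ∀ d : ℕ, 0 < d → ∀ δ, WeilVariationalHodgeComponent 3 d δ) : HodgeSimpleCMSixfold :=
  hodgeSimpleCMSixfold_of_generation_of_weilSixfolds hgen₀ hgen (weilSixfolds_of_divisorGeneratedCMPointed_holds hP hV)

/-! ### §5 R∞ from the δ-indexed leaves, minus `hE` -/

/-- **T5 minus `hE` — R∞ WITHOUT `HC_CM`** from CM-power-pointed families + δ-VHC on every component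
`(ℚ(√-d), 2n, δ)`, `n ≥ 2`. [cite: vanGeemen1994HodgeAV, Lemma 5.2 and Thm. 4.3] [cite: Schoen1988HodgeWeil, §6] -/
theorem weilClassesImaginaryQuadratic_of_forall_cmPowerPointedComponent_holds
    (hP : ∀ (n : ℕ), 2 ≤ n → ∀ (d : ℕ), 0 < d → ∀ δ : weilNormResidueGroup d,
      CMPowerPointedWeilFamiliesComponent n d δ)
    (hV : ∀ (n : ℕ), 2 ≤ n → ∀ (d : ℕ), 0 < d → ∀ δ : weilNormResidueGroup d,
      WeilVariationalHodgeComponent n d δ) : WeilClassesImaginaryQuadratic :=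
  weilClassesImaginaryQuadratic_of_forall_cmPowerPointedComponent polarizedWeilDiscriminantExists_holds hP hV

/-- **R∞ WITHOUT `HC_CM` (row W1′ on every component)**: divisor-generated-CM-pointed families + δ-VHC on every
component give Weil's question for imaginary quadratic `K`. [cite: vanGeemen1994HodgeAV, Thm. 4.3 and Lemma 5.2]
[cite: Abdulali1994FamiliesAV, (1.1) and Lemma 6.2] -/
theorem weilClassesImaginaryQuadratic_of_forall_divisorGeneratedCMPointedComponent
    (hP : ∀ (n : ℕ), 2 ≤ n → ∀ (d : ℕ), 0 < d → ∀ δ : weilNormResidueGroup d,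
      DivisorGeneratedCMPointedWeilFamiliesComponent n d δ)
    (hV : ∀ (n : ℕ), 2 ≤ n → ∀ (d : ℕ), 0 < d → ∀ δ : weilNormResidueGroup d,
      WeilVariationalHodgeComponent n d δ) : WeilClassesImaginaryQuadratic :=
  weilClassesImaginaryQuadratic_of_byComponent_holds fun n hn d hd δ ↦
    weilClassesComponent_of_divisorGeneratedCMPointed (hP n hn d hd δ) (hV n hn d hd δ)

/-- **R∞ with `HC_CM` NOMINAL (row W1 on every component)**: CM-pointed families + δ-VHC on every component, `HC_CM`
an ARGUMENT anchoring the CM fibres. [cite: Deligne1982HodgeCycles, §5] [cite: Abdulali1994FamiliesAV, Lemma 6.2] -/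
theorem weilClassesImaginaryQuadratic_of_HC_CM_of_forall_cmPointedComponent (hCM : RankFourFaces.CMAbelianHodge)
    (hP : ∀ (n : ℕ), 2 ≤ n → ∀ (d : ℕ), 0 < d → ∀ δ : weilNormResidueGroup d, CMPointedWeilFamiliesComponent n d δ)
    (hV : ∀ (n : ℕ), 2 ≤ n → ∀ (d : ℕ), 0 < d → ∀ δ : weilNormResidueGroup d,
      WeilVariationalHodgeComponent n d δ) : WeilClassesImaginaryQuadratic :=
  weilClassesImaginaryQuadratic_of_byComponent_holds fun n hn d hd δ ↦
    weilClassesComponent_of_HC_CM hCM (hP n hn d hd δ) (hV n hn d hd δ)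

/-! ### §6 R1′ from the non-split cells: only the Landherr binder remains -/

/-- **W4 (R1′) minus `hE`**: the NON-split sixfold cells `(3, d, δ ≠ -1)` give the rung `NonsplitSixfolds`, granted
the forward Landherr criterion (`LandherrSplitCriterion`, VII-B) only. [cite: vanGeemen1994HodgeAV, Lemma 5.2 and (5.4.1)]
[cite: Markman2025SurveySecant, §1.1 and §11.5 Step 1] -/
theorem nonsplitSixfolds_of_nonsplit_components_holds (hL : LandherrSplitCriterion)
    (h : ∀ (d : ℕ), 0 < d → ∀ δ : weilNormResidueGroup d, δ ≠ splitDiscriminantClass 3 d →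
      WeilClassesComponent 3 d δ) : NonsplitSixfolds :=
  nonsplitSixfolds_of_nonsplit_components hL polarizedWeilDiscriminantExists_holds h

/-- **S6 (R1′) minus `hE`**: the same from the CONVERSE Landherr node `LandherrHyperbolicOfSplitDiscriminant`
(part XXVIII) only. [cite: vanGeemen1994HodgeAV, Lemma 5.2 and (5.4.1)] [cite: Markman2025SurveySecant, §11.5 Step 1] -/
theorem nonsplitSixfolds_of_nonsplit_components_of_converse_holds (hL' : LandherrHyperbolicOfSplitDiscriminant)
    (h : ∀ (d : ℕ), 0 < d → ∀ δ : weilNormResidueGroup d, δ ≠ splitDiscriminantClass 3 d →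
      WeilClassesComponent 3 d δ) : NonsplitSixfolds :=
  nonsplitSixfolds_of_nonsplit_components_of_converse hL' polarizedWeilDiscriminantExists_holds h

/-! ### §7 Audit -/

/-- **Audit of part XXIX**: the supply node holds, and the two exactness rows of the δ-table are theorems with no
hypothesis. [cite: vanGeemen1994HodgeAV, Lemma 5.2 (PDF p. 220)] -/
theorem weilDiscriminant_rows_audit :
    PolarizedWeilDiscriminantExists ∧ (WeilClassesImaginaryQuadratic ↔ WeilClassesByComponent) ∧
      (SevenfoldWeilCensus.WeilSixfolds ↔ ∀ d : ℕ, 0 < d → ∀ δ : weilNormResidueGroup d, WeilClassesComponent 3 d δ) ∧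
      (SevenfoldWeilCensus.WeilSixfolds ↔
        NonsplitSixfolds ∧ ∀ d : ℕ, 0 < d → WeilClassesComponent 3 d (splitDiscriminantClass 3 d)) :=
  ⟨polarizedWeilDiscriminantExists_holds, weilClassesImaginaryQuadratic_iff_byComponent_holds,
    weilSixfolds_iff_components, weilSixfolds_iff_nonsplitSixfolds_and_split_components⟩

/-- ON-PATH: every row of this part is a case of the summit. [cite: Deligne2000, §1] -/
theorem weilDiscriminant_rows_of_hodgeConjecture (h : _root_.HodgeConjecture) :
    WeilClassesByComponent ∧ SevenfoldWeilCensus.WeilSixfolds ∧ NonsplitSixfolds :=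
  ⟨weilClassesByComponent_of_hodgeConjecture h, weilSixfolds_of_hodgeConjecture h, nonsplitSixfolds_of_hodgeConjecture h⟩

end Summit.HodgeConjecture.HodgeConjecture.Ring2.Hypotheses

end
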